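import Summits.Ventures.HodgeRepro2.T5Unitarization

/-!
# Character basics: `χ(1) = dim`, class function, `χ(g⁻¹) = conj χ(g)`, `|χ(g)| ≤ dim`

Blind cell `pub-hodge-repro2`, seat p1 (gen 12), Tier-5 kernel support for the character sentences of
`route/T5-SUPPORT-p1.md` §S4.7 / §S4.9.

The elementary properties of the character `χ_π(g) = tr π(g)` of a finite-dimensional representation:

* `character_one` — `χ_π(1) = dim V`;
* `character_conj` — `χ_π` is a class function (`tr(ABA⁻¹) = tr B`);
* `character_inv_of_isUnitary` — for a unitary `π`, `π g⁻¹ = (π g)†` and hence `χ_π(g⁻¹) = conj χ_π(g)`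
  (trace over an orthonormal basis, `LinearMap.trace_eq_sum_inner`);
* `norm_character_le_finrank_of_isUnitary` — `|χ_π(g)| ≤ dim V` for unitary `π` (Cauchy–Schwarz
  termwise over an orthonormal basis);
* **`character_inv`**, **`norm_character_le_finrank`** — the same for EVERY continuous
  finite-dimensional representation of a compact group, through the unitarized synonym of
  `T5Unitarization` (same character).

Print: Goodman–Wallach GTM 255 §4.3.1–4.3.2 (characters of finite groups; the same proofs for compact
groups, §7.3.4).  Honest scope (unchanged): finite-dimensional representations; compact groups for the
last two statements; nothing about π₃⁺ or (N).
-/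

namespace Summit.Ventures.HodgeRepro2.T5CharacterBasics

open MeasureTheory T5SchurOrthogonality T5Unitarization

section general

variable {G : Type*} [Group G]
variable {V : Type*} [NormedAddCommGroup V] [InnerProductSpace ℂ V] [FiniteDimensional ℂ V]
variable (π : G →* V →L[ℂ] V)

/-- `χ_π(1) = dim V`. -/
theorem character_one : character π 1 = Module.finrank ℂ V := by
  unfold character
  rw [map_one]
  exact LinearMap.trace_id ℂ V

omit [FiniteDimensional ℂ V] in
/-- The character is a class function: `χ_π(h g h⁻¹) = χ_π(g)`. -/
theorem character_conj (g h : G) : character π (h * g * h⁻¹) = character π g := by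
  unfold character
  rw [map_mul, map_mul, ContinuousLinearMap.toLinearMap_mul, ContinuousLinearMap.toLinearMap_mul,
    LinearMap.trace_mul_comm, ← mul_assoc, ← ContinuousLinearMap.toLinearMap_mul, ← map_mul,
    inv_mul_cancel, map_one, ContinuousLinearMap.toLinearMap_one, one_mul]

/-- For a unitary representation, `π g⁻¹` is the adjoint of `π g`. -/
theorem apply_inv_eq_adjoint (hu : IsUnitary π) (g : G) :
    π g⁻¹ = ContinuousLinearMap.adjoint (π g) := by
  haveI : CompleteSpace V := FiniteDimensional.complete ℂ V
  ext x
  apply ext_inner_right ℂ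
  intro y
  rw [ContinuousLinearMap.adjoint_inner_left, ← hu g (π g⁻¹ x) y, ← mul_apply_eq_comp, ← map_mul,
    mul_inv_cancel, map_one, one_apply_eq_self]

/-- For a unitary representation, `χ_π(g⁻¹) = conj χ_π(g)`. -/
theorem character_inv_of_isUnitary (hu : IsUnitary π) (g : G) :
    character π g⁻¹ = (starRingEnd ℂ) (character π g) := by
  haveI : CompleteSpace V := FiniteDimensional.complete ℂ V
  let b := stdOrthonormalBasis ℂ V
  unfold character
  rw [LinearMap.trace_eq_sum_inner _ b, LinearMap.trace_eq_sum_inner _ b, map_sum]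
  refine Finset.sum_congr rfl fun i _ => ?_
  rw [ContinuousLinearMap.coe_coe, ContinuousLinearMap.coe_coe, apply_inv_eq_adjoint π hu g,
    ContinuousLinearMap.adjoint_inner_right, inner_conj_symm]

/-- For a unitary representation, `|χ_π(g)| ≤ dim V` (termwise Cauchy–Schwarz over an orthonormal
basis, each `π g` being an isometry). -/
theorem norm_character_le_finrank_of_isUnitary (hu : IsUnitary π) (g : G) :
    ‖character π g‖ ≤ Module.finrank ℂ V := by
  let b := stdOrthonormalBasis ℂ V
  unfold character
  rw [LinearMap.trace_eq_sum_inner _ b]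
  calc ‖∑ i, inner ℂ (b i) ((π g : V →ₗ[ℂ] V) (b i))‖
      ≤ ∑ i, ‖inner ℂ (b i) ((π g : V →ₗ[ℂ] V) (b i))‖ := norm_sum_le _ _
    _ ≤ ∑ i : Fin (Module.finrank ℂ V), (1 : ℝ) := by
        refine Finset.sum_le_sum fun i _ => ?_
        calc ‖inner ℂ (b i) ((π g : V →ₗ[ℂ] V) (b i))‖
            ≤ ‖b i‖ * ‖(π g : V →ₗ[ℂ] V) (b i)‖ := norm_inner_le_norm _ _
          _ = 1 := by
              rw [ContinuousLinearMap.coe_coe]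
              have hn : ‖π g (b i)‖ = ‖b i‖ := by
                rw [@norm_eq_sqrt_re_inner ℂ, hu g, ← @norm_eq_sqrt_re_inner ℂ]
              rw [hn, b.orthonormal.1 i, one_mul]
    _ = Module.finrank ℂ V := by simp

end general

section compact

variable {G : Type*} [Group G] [TopologicalSpace G] [IsTopologicalGroup G]
  [MeasurableSpace G] [BorelSpace G] [CompactSpace G]
variable {V : Type*} [NormedAddCommGroup V] [InnerProductSpace ℂ V] [FiniteDimensional ℂ V]
variable (μ : Measure G) [IsProbabilityMeasure μ] [μ.IsOpenPosMeasure] [μ.IsMulLeftInvariant]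
variable (π : G →* V →L[ℂ] V)

include μ in
/-- **`χ_π(g⁻¹) = conj χ_π(g)`** for every continuous finite-dimensional representation of a compact
group (no unitarity: the unitarized synonym has the same character). -/
theorem character_inv (hπ : Continuous π) (g : G) :
    character π g⁻¹ = (starRingEnd ℂ) (character π g) :=
  character_inv_of_isUnitary (unitarizedRep μ π hπ) (isUnitary_unitarizedRep μ π hπ) g

include μ in
/-- **`|χ_π(g)| ≤ dim V`** for every continuous finite-dimensional representation of a compact group. -/
theorem norm_character_le_finrank (hπ : Continuous π) (g : G) :
    ‖character π g‖ ≤ Module.finrank ℂ V :=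
  norm_character_le_finrank_of_isUnitary (unitarizedRep μ π hπ) (isUnitary_unitarizedRep μ π hπ) g

end compact

end Summit.Ventures.HodgeRepro2.T5CharacterBasics
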